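import Literature.Geometry.Riemannian.L2HarmonicOneFormsSobolev
import Literature.Geometry.Lorentzian.GreenIdentity
import HarnessLib

/-!
# Towards Carron 1998, Thm. 3.3 (ends and `L²` harmonic `1`-forms): the algebraic reductions

Sibling proofs file of `Literature/Geometry/Riemannian/L2HarmonicOneFormsSobolev.lean`, first
layer of the proof programme of the named fact `Carron1998_ends_le_rank_l2HarmonicOneForms`
(G. Carron, Duke Math. J. 95 (1998), Thm. 0.3 = Thm. 3.3; proof architecture as in G. Carron,
*L² harmonic forms on non-compact Riemannian manifolds*, arXiv:0704.3194 (2007), Lemma 2.1,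
Prop. 2.5 and Prop. 2.11): on a connected complete Riemannian manifold `(X, h)` satisfying the
Sobolev inequality `(S_p)`, `k` ends give `k - 1` independent `L²` harmonic `1`-forms.

The printed proof (Carron 2007, Prop. 2.5 with Prop. 2.11) produces, for a compact `K` with
`X ∖ K ⊇ U₁ ⊔ … ⊔ U_k` (unbounded components), functions `hᵢ = uᵢ - vᵢ ∈ C^∞(X)` with
`Δ hᵢ = 0`, `dhᵢ ∈ L²`, `uᵢ = δᵢⱼ` on the far part of `Uⱼ`, and `vᵢ ∈ L^{2p/(p-2)}` (the Sobolev
exponent), and concludes by: a vanishing linear combination of the `dhᵢ` is the differential of a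
constant `c = ∑ cᵢ hᵢ` (`X` connected), and evaluating "far out in `Uⱼ`", where all the ends have
infinite volume (Carron 2007, Lemma 2.7 and the volume lower bound of Prop. 2.11), forces
`c = 0` and `cᵢ = 0`. This file PROVES these model-independent, non-analytic steps, in the
vocabulary of `L2HarmonicOneFormsSobolev.lean`:

* `natCast_le_rank_add_one_of_linearIndependent` — `k - 1` independent vectors give
  `k ≤ rank + 1` (cardinal arithmetic);
* `Carron1998_ends_le_rank_l2HarmonicOneForms_of_forall_exists_linearIndependent` — the fact
  follows from: for `k ≥ 2` ends there are `k - 1` linearly independent members of `ℋ¹(X, h)`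
  (the cases `k ≤ 1` being void);
* `mvfderiv_mem_l2HarmonicOneForms` — **`dh ∈ ℋ¹(X, h)` for a harmonic function `h` with
  `dh ∈ L²`** (Carron 2007, proof of Prop. 2.5: "`dh = η ∈ L²` and `Δh = d*dh = 0`"): `d(dh) = 0`
  and `d*(dh) = -□_h h` by `covDerivOneForm_mvfderiv` (`∇(dh) = Hess h`);
* `apply_eq_of_mvfderiv_eq_zero` — on a connected boundaryless manifold a differentiable function
  with `du = 0` is constant (mean value theorem in charts; Carron: "`M` is connected hence we have
  a constant `c` such that `u = f + c`", proof of Lemma 2.1);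
* `eq_zero_of_sum_mul_sub_eq_const` — **the evaluation at the ends**, measure-theoretically: if
  `∑ᵢ cᵢ (χᵢ - vᵢ) = c` a.e., where `χᵢ = δᵢⱼ` on sets `Cⱼ` of infinite measure, the `vᵢ` have
  finite `L^q`-seminorm (`0 < q < ∞`) and `c_{i₀} = 0` for one index, then all `cᵢ = 0`
  (a non-zero constant on a set of infinite measure is not in `L^q`);
* `linearIndependent_mvfderiv_of_ends` — assembled: under these hypotheses the differentials
  `d(χᵢ - vᵢ)`, `i ≠ i₀`, of everywhere differentiable representatives are linearly independent.

Everything is proved; no definitions, no named facts (D-0026). The analytic and geometric layers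
(energy minimisation, Weyl lemma, Sobolev ⇒ volume growth, Hopf–Rinow) are the business of
sequel files.

## References

* G. Carron, *Une suite exacte en L²-cohomologie*, Duke Math. J. 95 (1998) 343–372, Thm. 0.3 =
  Thm. 3.3. [`Carron1998`]
* G. Carron, *L² harmonic forms on non-compact Riemannian manifolds*, arXiv:0704.3194 (2007),
  Lemma 2.1, Prop. 2.5, Lemma 2.7, Prop. 2.11. [`Carron2007`]
-/

noncomputable section

open Bundle Set Function Filter
open scoped Manifold ContDiff Topology ENNReal NNReal

namespace Literature.Geometry.Riemannian

open _root_.MeasureTheory Literature.Geometry.Lorentzian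

/-! ### Cardinal bookkeeping and the reduction of the fact -/

/-- `k - 1` linearly independent vectors give `k ≤ rank + 1` (as cardinals; void for `k = 0`).
[folklore] -/
theorem natCast_le_rank_add_one_of_linearIndependent {K V : Type*} [DivisionRing K]
    [AddCommGroup V] [Module K V] {k : ℕ} {v : Fin (k - 1) → V} (hv : LinearIndependent K v) :
    (k : Cardinal) ≤ Module.rank K V + 1 := by
  have h1 : ((k - 1 : ℕ) : Cardinal) ≤ Module.rank K V := by
    simpa using hv.cardinal_lift_le_rank
  calc (k : Cardinal) ≤ ((k - 1 : ℕ) : Cardinal) + 1 := by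
        have : k ≤ (k - 1) + 1 := by omega
        exact_mod_cast this
    _ ≤ Module.rank K V + 1 := add_le_add h1 le_rfl

/-- **Reduction of Carron's theorem to the construction of independent harmonic forms.** The
named fact `Carron1998_ends_le_rank_l2HarmonicOneForms` follows once, for every connected
complete `(X, h)` with `(S_p)` and at least `k ≥ 2` ends, `k - 1` linearly independent members
of `ℋ¹(X, h)` are exhibited (for `k ≤ 1` the inequality `k ≤ dim ℋ¹ + 1` is void). Carron 2007,
Prop. 2.5 (the span of `h` and `1` has dimension `2`). [cite: Carron2007, Prop. 2.5] -/
theorem Carron1998_ends_le_rank_l2HarmonicOneForms_of_forall_exists_linearIndependent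
    (H : ∀ {E : Type} [NormedAddCommGroup E] [NormedSpace ℝ E] [FiniteDimensional ℝ E]
      {H : Type} [TopologicalSpace H] (I : ModelWithCorners ℝ E H) (X : Type) [TopologicalSpace X]
      [ChartedSpace H X] [IsManifold I ∞ X] [BoundarylessManifold I X] [T3Space X]
      [SecondCountableTopology X] [MeasurableSpace X] [BorelSpace X] [ConnectedSpace X]
      (h : ContMDiffRiemannianMetric I ∞ E (TangentSpace I : X → Type _))
      [(PseudoRiemannianMetric.ofRiemannian h).HasLeviCivita] (p μ : ℝ), 2 < p → 0 < μ →
      IsGeodesicallyComplete (PseudoRiemannianMetric.ofRiemannian h).leviCivita →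
      HasSobolevInequality h p μ →
      ∀ k : ℕ, 2 ≤ k → HasAtLeastEnds X k →
        ∃ v : Fin (k - 1) → l2HarmonicOneForms h, LinearIndependent ℝ v) :
    Carron1998_ends_le_rank_l2HarmonicOneForms := by
  intro E _ _ _ H' _ I X _ _ _ _ _ _ _ _ _ h _ p μ hp hμ hc hS k hk
  rcases lt_or_ge k 2 with hk2 | hk2
  · calc (k : Cardinal) ≤ 1 := by exact_mod_cast Nat.lt_succ_iff.1 hk2
      _ ≤ Module.rank ℝ (l2HarmonicOneForms h) + 1 := le_add_self
  · obtain ⟨v, hv⟩ := H I X h p μ hp hμ hc hS k hk2 hk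
    exact natCast_le_rank_add_one_of_linearIndependent (K := ℝ) (V := l2HarmonicOneForms h) hv

/-! ### Differentials of harmonic functions with finite energy -/

section Harmonic

variable {E : Type*} [NormedAddCommGroup E] [NormedSpace ℝ E] {H : Type*} [TopologicalSpace H]
  {I : ModelWithCorners ℝ E H} {X : Type*} [TopologicalSpace X] [ChartedSpace H X]
  [IsManifold I ∞ X]
variable [FiniteDimensional ℝ E] [T3Space X] [MeasurableSpace X] [BorelSpace X]
  (h : ContMDiffRiemannianMetric I ∞ E (TangentSpace I : X → Type _))
  [(PseudoRiemannianMetric.ofRiemannian h).HasLeviCivita]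

/-- **The differential of a harmonic function with finite Dirichlet energy is an `L²` harmonic
`1`-form.** If `u : X → ℝ` is `C²`, harmonic (`□_h u = tr_h Hess u = 0`), `∫_X |du|²_h dV_h < ∞`,
and `du` is `C^∞` as a section of `T*X`, then `du ∈ ℋ¹(X, h)`: `∇(du) = Hess u` is symmetric
(`dα = 0`) and has trace `□_h u = 0` (`d*α = 0`). Carron 2007, proof of Prop. 2.5 ("`dh = η ∈ L²`
and `Δ h = d*d(u - v) = d*η = 0`"). [cite: Carron2007, Prop. 2.5] -/
theorem mvfderiv_mem_l2HarmonicOneForms {u : X → ℝ}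
    (hs : ∀ x, ContMDiffAt I (I.prod 𝓘(ℝ, E →L[ℝ] ℝ)) ∞ (oneFormSection (mvfderiv I u)) x)
    (hu : ∀ x, CMDiffAt 2 u x)
    (hΔ : ∀ x, (PseudoRiemannianMetric.ofRiemannian h).dalembertian u x = 0)
    (hL2 : ∫⁻ x, ENNReal.ofReal ((PseudoRiemannianMetric.ofRiemannian h).innerDual x
        (mvfderiv I u x).toLinearMap (mvfderiv I u x).toLinearMap) ∂(riemannianMeasure h) < ⊤) :
    mvfderiv I u ∈ l2HarmonicOneForms h := by
  haveI : CompleteSpace E := FiniteDimensional.complete ℝ E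
  haveI : Fact ((1 : ℕ∞ω) ≤ ((⊤ : ℕ∞) : ℕ∞ω)) := ⟨by exact_mod_cast le_top⟩
  rw [mem_l2HarmonicOneForms_iff]
  refine ⟨hs, hL2, fun x ↦ isSymm_covDerivOneForm_mvfderiv (hu x), fun x ↦ ?_⟩
  rw [trace_covDerivOneForm_mvfderiv (hu x)]
  exact hΔ x

end Harmonic

/-! ### Functions with vanishing differential on a connected manifold -/

section Constant

variable {E : Type*} [NormedAddCommGroup E] [NormedSpace ℝ E] {H : Type*} [TopologicalSpace H]
  {I : ModelWithCorners ℝ E H} {X : Type*} [TopologicalSpace X] [ChartedSpace H X]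

/-- `mvfderiv` and `mfderiv` of a real function agree (the identification
`NormedSpace.fromTangentSpace` of `T_{u x} ℝ` with `ℝ` is the identity). [folklore] -/
theorem mvfderiv_apply_eq_mfderiv (u : X → ℝ) (x : X) (v : TangentSpace I x) :
    mvfderiv I u x v = mfderiv I 𝓘(ℝ, ℝ) u x v := rfl

/-- `mvfderiv I u x = 0` iff `mfderiv I 𝓘(ℝ, ℝ) u x = 0`. [folklore] -/
theorem mvfderiv_eq_zero_iff (u : X → ℝ) (x : X) :
    mvfderiv I u x = 0 ↔ mfderiv I 𝓘(ℝ, ℝ) u x = 0 := by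
  constructor <;> intro h0 <;> ext v
  · exact congrArg (fun L : TangentSpace I x →L[ℝ] ℝ ↦ L v) h0
  · exact congrArg (fun L : TangentSpace I x →L[ℝ] TangentSpace 𝓘(ℝ, ℝ) (u x) ↦ L v) h0

variable [IsManifold I 1 X]

/-- **A differentiable function with identically vanishing differential on a connected manifold
without boundary is constant** (in the extended chart at `x₀` the function `u ∘ φ⁻¹` has zero
derivative on a ball around `φ x₀`, hence is constant there by the mean value theorem; then
connectedness). Carron 2007, proof of Lemma 2.1 ("`M` is connected hence we have a constant `c`
such that `u = f + c`"). [folklore] -/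
theorem apply_eq_of_mvfderiv_eq_zero [ConnectedSpace X] [BoundarylessManifold I X] {u : X → ℝ}
    (hu : ∀ x, MDiffAt u x) (h0 : ∀ x, mvfderiv I u x = 0) (x y : X) : u x = u y := by
  suffices hloc : IsLocallyConstant u from hloc.apply_eq_of_preconnectedSpace x y
  refine (IsLocallyConstant.iff_eventually_eq u).2 fun x₀ ↦ ?_
  set φ := extChartAt I x₀ with hφ
  set F : E → ℝ := u ∘ φ.symm with hF
  -- a ball inside the chart target around `φ x₀` (an interior point)
  have htgt : φ.target ∈ 𝓝 (φ x₀) := by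
    have hint : φ x₀ ∈ interior φ.target :=
      I.isInteriorPoint_iff.1 (BoundarylessManifold.isInteriorPoint (I := I) (x := x₀))
    exact mem_interior_iff_mem_nhds.1 hint
  obtain ⟨r, hr, hball⟩ := Metric.mem_nhds_iff.1 htgt
  -- `F` is differentiable with zero derivative on the ball
  have hFd : ∀ z ∈ Metric.ball (φ x₀) r, DifferentiableAt ℝ F z ∧ fderiv ℝ F z = 0 := by
    intro z hz
    have hzt : z ∈ φ.target := hball hz
    have hnz : range I ∈ 𝓝 z := mem_of_superset (Metric.isOpen_ball.mem_nhds hz)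
      (hball.trans (extChartAt_target_subset_range x₀))
    have h1 : MDifferentiableAt 𝓘(ℝ, E) I φ.symm z :=
      (mdifferentiableWithinAt_extChartAt_symm hzt).mdifferentiableAt hnz
    have h2 : MDifferentiableAt I 𝓘(ℝ, ℝ) u (φ.symm z) := hu _
    have h3 : MDifferentiableAt 𝓘(ℝ, E) 𝓘(ℝ, ℝ) F z := h2.comp z h1
    have h4 : mfderiv 𝓘(ℝ, E) 𝓘(ℝ, ℝ) F z = 0 := by
      rw [hF, mfderiv_comp z h2 h1, (mvfderiv_eq_zero_iff u _).1 (h0 _)]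
      exact ContinuousLinearMap.zero_comp _
    refine ⟨mdifferentiableAt_iff_differentiableAt.1 h3, ?_⟩
    rwa [mfderiv_eq_fderiv] at h4
  have hconst : ∀ z ∈ Metric.ball (φ x₀) r, F z = F (φ x₀) := by
    intro z hz
    refine (convex_ball (φ x₀) r).is_const_of_fderivWithin_eq_zero (𝕜 := ℝ)
      (fun w hw ↦ (hFd w hw).1.differentiableWithinAt) ?_ hz (Metric.mem_ball_self hr)
    intro w hw
    rw [fderivWithin_of_isOpen Metric.isOpen_ball hw]
    exact (hFd w hw).2
  -- pull back to the manifold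
  have hsrc : ∀ᶠ y in 𝓝 x₀, y ∈ φ.source := extChartAt_source_mem_nhds (I := I) x₀
  have hpre : ∀ᶠ y in 𝓝 x₀, φ y ∈ Metric.ball (φ x₀) r :=
    (continuousAt_extChartAt (I := I) x₀).preimage_mem_nhds (Metric.ball_mem_nhds _ hr)
  filter_upwards [hsrc, hpre] with y hy hyb
  have e1 : u y = F (φ y) := by
    simp only [hF, Function.comp_apply, φ.left_inv hy]
  have e2 : u x₀ = F (φ x₀) := by
    simp only [hF, Function.comp_apply, φ.left_inv (mem_extChartAt_source (I := I) x₀)]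
  rw [e1, e2, hconst _ hyb]

end Constant

/-! ### Evaluation at the ends: the measure-theoretic independence lemma -/

section Ends

variable {X : Type*} [MeasurableSpace X] {μ : Measure X} {ι : Type*} [Fintype ι]

/-- **A non-zero constant is not `L^q` on a set of infinite measure**: if `f = b` a.e. on `C`,
`μ C = ⊤` and `‖f‖_{L^q(μ)} < ⊤` for some `0 < q < ⊤`, then `b = 0`. [folklore] -/
theorem eq_zero_of_eLpNorm_lt_top_of_ae_eq_const {f : X → ℝ} {C : Set X} (hC : μ C = ⊤)
    {b : ℝ} (hf : ∀ᵐ x ∂μ.restrict C, f x = b) {q : ℝ≥0∞} (hq0 : q ≠ 0) (hq : q ≠ ⊤)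
    (hfq : eLpNorm f q μ < ⊤) : b = 0 := by
  by_contra hb
  have h1 : eLpNorm f q (μ.restrict C) = eLpNorm (fun _ : X ↦ b) q (μ.restrict C) :=
    eLpNorm_congr_ae hf
  have hC0 : μ.restrict C ≠ 0 := by
    intro h0
    have h1 : μ.restrict C univ = 0 := by rw [h0, Measure.coe_zero, Pi.zero_apply]
    rw [Measure.restrict_apply_univ] at h1
    rw [h1] at hC
    exact ENNReal.zero_ne_top hC
  have h2 : eLpNorm (fun _ : X ↦ b) q (μ.restrict C) = ⊤ := by
    rw [eLpNorm_const b hq0 hC0, Measure.restrict_apply_univ, hC]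
    have hpos : 0 < 1 / q.toReal := by
      have : 0 < q.toReal := ENNReal.toReal_pos hq0 hq
      positivity
    rw [ENNReal.top_rpow_of_pos hpos, ENNReal.mul_top]
    simpa using hb
  have h3 : eLpNorm f q (μ.restrict C) ≤ eLpNorm f q μ :=
    eLpNorm_mono_measure f Measure.restrict_le_self
  rw [h1, h2] at h3
  exact (lt_irrefl _) (lt_of_le_of_lt h3 hfq)

/-- **Evaluation at the ends.** Let `Cⱼ` (`j : ι`) be measurable sets of infinite measure, `χᵢ`
functions with `χᵢ = δᵢⱼ` on `Cⱼ`, and `vᵢ` a.e.-strongly measurable functions with finite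
`L^q`-seminorm (`0 < q < ⊤`). If a combination `∑ᵢ cᵢ (χᵢ - vᵢ)` with `c_{i₀} = 0` is a.e. equal to
a constant `a`, then `cᵢ = 0` for all `i` (and `a = 0`): on `C_{i₀}` the combination is
`-∑ cᵢ vᵢ ∈ L^q`, so `a = 0`; on `Cⱼ` it is `cⱼ - ∑ cᵢ vᵢ`, so `cⱼ = a = 0`. This is the last
paragraph of Carron's proofs of Prop. 2.4/2.11 and Remark 2.6 ("since all unbounded connected
components … have infinite volume and since `f ∈ L²`, we see that `f` has compact support";
"`∫_{U±} |u - (±1)|² < ⊤` but … the volume of `U±` are infinite hence `u` cannot be the constant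
function"). [cite: Carron2007, Prop. 2.11 and Remark 2.6] -/
theorem eq_zero_of_sum_mul_sub_ae_eq_const [DecidableEq ι] {C : ι → Set X}
    (hCm : ∀ j, MeasurableSet (C j)) (hC : ∀ j, μ (C j) = ⊤)
    {χ v : ι → X → ℝ} (hχ : ∀ i j, ∀ x ∈ C j, χ i x = if i = j then 1 else 0)
    (hvm : ∀ i, AEStronglyMeasurable (v i) μ) {q : ℝ≥0∞} (hq0 : q ≠ 0) (hq : q ≠ ⊤)
    (hv : ∀ i, eLpNorm (v i) q μ < ⊤) {i₀ : ι} {c : ι → ℝ} (hc₀ : c i₀ = 0) {a : ℝ}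
    (hsum : ∀ᵐ x ∂μ, ∑ i, c i * (χ i x - v i x) = a) : c = 0 := by
  -- the combination `w = ∑ cᵢ vᵢ` is in `L^q`
  set w : X → ℝ := fun x ↦ ∑ i, c i * v i x with hw
  have hwq : eLpNorm w q μ < ⊤ := by
    have hmem : MemLp w q μ := by
      have : w = ∑ i, fun x ↦ c i * v i x := by
        funext x; simp [hw, Finset.sum_apply]
      rw [this]
      exact memLp_finsetSum' _ fun i _ ↦ MemLp.const_mul ⟨hvm i, hv i⟩ (c i)
    exact hmem.eLpNorm_lt_top
  -- on `C j`, `w = c j - a` a.e., hence `c j = a`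
  have key : ∀ j, c j = a := by
    intro j
    have hae : ∀ᵐ x ∂μ.restrict (C j), w x = c j - a := by
      filter_upwards [ae_restrict_mem (hCm j), ae_restrict_of_ae hsum] with x hx hx'
      have hχj : ∑ i, c i * χ i x = c j := by
        rw [Finset.sum_congr rfl fun i _ ↦ by rw [hχ i j x hx]]
        simp [Finset.sum_ite_eq']
      have hsplit : ∑ i, c i * (χ i x - v i x) = ∑ i, c i * χ i x - w x := by
        simp only [hw, mul_sub, Finset.sum_sub_distrib]
      linarith
    have h0 := eq_zero_of_eLpNorm_lt_top_of_ae_eq_const (hC j) hae hq0 hq hwq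
    linarith
  have ha : a = 0 := by rw [← key i₀, hc₀]
  funext i
  rw [Pi.zero_apply, key i, ha]

end Ends

/-! ### Assembly: independence of the differentials -/

section Independence

variable {E : Type*} [NormedAddCommGroup E] [NormedSpace ℝ E] {H : Type*} [TopologicalSpace H]
  {I : ModelWithCorners ℝ E H} {X : Type*} [TopologicalSpace X] [ChartedSpace H X]
  [IsManifold I 1 X] [ConnectedSpace X] [BoundarylessManifold I X]
  [MeasurableSpace X] {μ : Measure X} {ι : Type*} [Fintype ι] [DecidableEq ι]

omit [IsManifold I 1 X] [ConnectedSpace X] [BoundarylessManifold I X] [MeasurableSpace X] in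
/-- `d(c u) = c du` for a differentiable real function. [folklore] -/
theorem mvfderiv_const_mul {u : X → ℝ} {x : X} (hu : MDiffAt u x) (c : ℝ) :
    mvfderiv I (fun y ↦ c * u y) x = c • mvfderiv I u x := by
  rw [mvfderiv_fun_mul mdifferentiableAt_const hu, mvfderiv_const]
  simp

/-- **Independence of the differentials of the end potentials** (Carron 2007, proof of
Prop. 2.5: "because `η ≠ 0` we know that `h` is not the constant function. The linear span of `h`
and of the constant function `1` is of dimension `2`", for `k` ends in the form used here). On a
connected boundaryless manifold with a measure `μ`, let `Cⱼ` be measurable sets of infinite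
measure, `χᵢ = δᵢⱼ` on `Cⱼ`, `vᵢ` with finite `L^q`-seminorm (`0 < q < ⊤`), and `uᵢ` everywhere
differentiable functions with `uᵢ = χᵢ - vᵢ` a.e.; then the differentials `duᵢ`, `i ≠ i₀`, are
linearly independent (a vanishing combination `∑ cᵢ duᵢ = d(∑ cᵢ uᵢ) = 0` makes `∑ cᵢ uᵢ`
constant, `apply_eq_of_mvfderiv_eq_zero`, and `eq_zero_of_sum_mul_sub_ae_eq_const` applies).
[cite: Carron2007, Prop. 2.5] -/
theorem linearIndependent_mvfderiv_of_ends {C : ι → Set X} (hCm : ∀ j, MeasurableSet (C j))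
    (hC : ∀ j, μ (C j) = ⊤) {u χ v : ι → X → ℝ}
    (hχ : ∀ i j, ∀ x ∈ C j, χ i x = if i = j then 1 else 0)
    (huv : ∀ i, ∀ᵐ x ∂μ, u i x = χ i x - v i x) (hvm : ∀ i, AEStronglyMeasurable (v i) μ)
    {q : ℝ≥0∞} (hq0 : q ≠ 0) (hq : q ≠ ⊤) (hv : ∀ i, eLpNorm (v i) q μ < ⊤)
    (hu : ∀ i x, MDiffAt (u i) x) (i₀ : ι) :
    LinearIndependent ℝ fun i : {i // i ≠ i₀} ↦ mvfderiv I (u i.1) := by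
  rw [Fintype.linearIndependent_iff]
  intro g hg i
  -- extend the coefficients by `0` at `i₀`
  set c : ι → ℝ := fun j ↦ if hj : j = i₀ then 0 else g ⟨j, hj⟩ with hc
  have hc₀ : c i₀ = 0 := by simp [hc]
  have hcg : ∀ j : {j // j ≠ i₀}, c j.1 = g j := fun j ↦ by simp [hc, j.2]
  -- `∑ cⱼ duⱼ = 0`
  have hsum0 : ∑ j, c j • mvfderiv I (u j) = 0 := by
    have h1 : ∑ j, c j • mvfderiv I (u j) =
        ∑ j ∈ Finset.univ.filter (fun j ↦ j ≠ i₀), c j • mvfderiv I (u j) := by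
      rw [Finset.sum_filter]
      refine Finset.sum_congr rfl fun j _ ↦ ?_
      by_cases hj : j = i₀
      · subst hj; simp [hc₀]
      · simp [hj]
    have h2 : ∑ j ∈ Finset.univ.filter (fun j ↦ j ≠ i₀), c j • mvfderiv I (u j) =
        ∑ j : {j // j ≠ i₀}, c j.1 • mvfderiv I (u j.1) :=
      Finset.sum_subtype _ (fun j ↦ by simp) fun j ↦ c j • mvfderiv I (u j)
    rw [h1, h2, ← hg]
    exact Finset.sum_congr rfl fun j _ ↦ by rw [hcg j]
  -- hence `W = ∑ cⱼ uⱼ` has vanishing differential and is constant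
  set W : X → ℝ := fun x ↦ ∑ j, c j * u j x with hW
  have hWd : ∀ x, MDiffAt W x ∧ mvfderiv I W x = 0 := by
    intro x
    obtain ⟨hd, heq⟩ := mvfderiv_finset_sum (I := I) Finset.univ (F := fun j y ↦ c j * u j y)
      (p := x) fun j _ ↦ (mdifferentiableAt_const.mul (hu j x))
    refine ⟨hd, ?_⟩
    rw [heq, Finset.sum_congr rfl fun j _ ↦ mvfderiv_const_mul (hu j x) (c j)]
    have := congrArg (fun F : Π y : X, TangentSpace I y →L[ℝ] ℝ ↦ F x) hsum0
    simpa [Finset.sum_apply] using this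
  -- the index `i₀` witnesses that `X` is nonempty (`μ (C i₀) = ⊤`)
  have hne : (C i₀).Nonempty := by
    by_contra hem
    rw [Set.not_nonempty_iff_eq_empty] at hem
    have := hC i₀
    rw [hem, measure_empty] at this
    exact ENNReal.zero_ne_top this
  obtain ⟨x₀, -⟩ := hne
  have hconst : ∀ x, W x = W x₀ := fun x ↦
    apply_eq_of_mvfderiv_eq_zero (fun y ↦ (hWd y).1) (fun y ↦ (hWd y).2) x x₀
  -- the measure-theoretic lemma
  have hae : ∀ᵐ x ∂μ, ∑ j, c j * (χ j x - v j x) = W x₀ := by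
    have hall : ∀ᵐ x ∂μ, ∀ j, u j x = χ j x - v j x := ae_all_iff.2 huv
    filter_upwards [hall] with x hx
    rw [← hconst x, hW]
    exact Finset.sum_congr rfl fun j _ ↦ by rw [hx j]
  have hc0 : c = 0 := eq_zero_of_sum_mul_sub_ae_eq_const hCm hC hχ hvm hq0 hq hv hc₀ hae
  have := hcg i
  rw [hc0, Pi.zero_apply] at this
  exact this.symm

end Independence

end Literature.Geometry.Riemannian

end
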